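import Summits.CriticalPhenomena.PercolationContinuityZ3.Theorems.PercShatteringRaceNearLinearTwoClusterDecaySplitCore
import Summits.CriticalPhenomena.PercolationContinuityZ3.Theorems.PercShatteringRaceNearLinearTwoClusterDecayOfShellNonCertainty
import Literature.Probability.Percolation.UniformPercolation
import HarnessLib

/-!
# Crux `PercShatteringRace.NearLinearTwoClusterDecay` (stmt-CriticalPhenomena-5785) — child 1 in the orthodox world

Helper file of the lead (seat c4) of the line `pair-decay-long-arms-dense`; lands with
`--supports stmt-CriticalPhenomena-5785` (registered stub `stub_pairDecayNullWorld` of skeleton rev L1-c4).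

**`θ(p_c) = 0 ⇒ PairTwoArmsDecay`.**  The proposed sub-crux `PairTwoArmsDecay` (pair form of
`U(1/6)`: for a deterministic pair `x, x' ∈ Λ(n)`, both reach `∂ⁱⁿΛ(m)` inside `Λ(m)`,
`m = ⌈n^{7/6}⌉`, without being joined inside `Λ(m)`) is AUTOMATIC in the orthodox world: the pair
event is contained in the one-arm event "`x` reaches `∂ⁱⁿΛ(m)` inside `Λ(m)`"
(`NearLinearTwoClusterDecaySplit.reachesOut`), which for `x ∈ Λ(n)` forces an arm of length `m - n`
at `x` (first exit, `DCT16.armEvent_of_pathIn`; the geometry is that of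
`Negative.exists_armEvent_of_crossingEvt`), of probability `P(0 ↔ ∂Λ_{m-n})` by translation
invariance (`DCT16.real_armEvent`); and `P(0 ↔ ∂Λ_k) → θ(p_c)` (`tendsto_real_siteToBoundary`,
Grimmett 1999 §1.4) with `m - n ≥ n → ∞` (`eventually_mul_le_ceil_rpow`).  So the whole content of
child 1 is its JUMP-WORLD half `0 < θ(p_c) → PairTwoArmsDecay` (stub `stub_pairDecayJumpWorld`).
No uniqueness, no BK; pure first-exit bookkeeping over landed lemmas.
-/

noncomputable section

namespace Summit.CriticalPhenomena.PercolationContinuityZ3.Theorems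

namespace NearLinearTwoClusterDecaySplit

open MeasureTheory Filter Topology
open Literature.Probability.LatticeModels Literature.Probability.Percolation
open Summit.CriticalPhenomena.PercolationContinuityZ3.Theses.PercShatteringRace

/-- **First exit, pointwise**: for `x ∈ Λ(n)`, `n ≤ m`, and a lattice configuration `ω`, if `x`
reaches `∂ⁱⁿΛ(m)` inside `Λ(m)` then `ω ∈ armEvent x (m - n)` (an arm from `x` to the boundary of
`x + Λ(m-n) ⊆ Λ(m)`).  Geometry copied from `Negative.exists_armEvent_of_crossingEvt`. [folklore] -/
theorem armEvent_of_mem_reachesOut {n m : ℕ} (hnm : n ≤ m) {x : Site 3} (hx : x ∈ box 3 n)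
    {ω : BondConfig (Site 3)} (hω : ω ⊆ (zdGraph 3).edgeSet) (h : ω ∈ reachesOut m x) :
    ω ∈ DCT16.armEvent x (m - n) := by
  obtain ⟨y, hy, hxy⟩ := h
  refine DCT16.armEvent_of_pathIn hω (DCT16.mem_openConnIn_iff_pathIn.1 hxy) ?_
  by_cases hbox : y - x ∈ box 3 (m - n)
  · right
    rw [mem_innerBoundary_iff]
    refine ⟨hbox, ?_⟩
    obtain ⟨hym, z, hz, hadj⟩ := mem_innerBoundary_iff.1 hy
    rw [mem_box] at hym hbox hx
    have hz' : ∃ j, ¬(-((m : ℕ) : ℤ) ≤ z j ∧ z j ≤ m) := by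
      by_contra hcon
      push Not at hcon
      exact hz (mem_box.2 hcon)
    obtain ⟨j, hj⟩ := hz'
    have hyj := hym j
    have hxj := hx j
    have hbj := hbox j
    simp only [Pi.sub_apply] at hbj
    rw [zdGraph_adj_iff] at hadj
    obtain ⟨i, hi⟩ := hadj
    by_cases hji : j = i
    · subst hji
      rcases hi with hi | hi
      · have hzj : z j = y j + 1 := by rw [hi]; simp
        refine ⟨y - x + Pi.single j 1, ?_, ?_⟩
        · rw [mem_box]; intro hcon
          have := hcon j
          simp only [Pi.add_apply, Pi.sub_apply, Pi.single_eq_same] at this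
          omega
        · rw [zdGraph_adj_iff]; exact ⟨j, Or.inl rfl⟩
      · have hzj : y j = z j + 1 := by rw [hi]; simp
        refine ⟨y - x - Pi.single j 1, ?_, ?_⟩
        · rw [mem_box]; intro hcon
          have := hcon j
          simp only [Pi.sub_apply, Pi.single_eq_same] at this
          omega
        · rw [zdGraph_adj_iff]; exact ⟨j, Or.inr (by simp)⟩
    · exfalso
      rcases hi with hi | hi
      · have hzj : z j = y j := by rw [hi]; simp [hji]
        omega
      · have hzj : y j = z j := by rw [hi]; simp [hji]
        omega
  · exact Or.inl hbox

/-- **One-arm bound for the in-box arm event**: for `x ∈ Λ(n)`, `n ≤ m`, and every `p`,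
`P_p(x reaches ∂ⁱⁿΛ(m) inside Λ(m)) ≤ P_p(0 ↔ ∂Λ_{m-n})` (first exit + translation invariance). [folklore] -/
theorem real_reachesOut_le_siteToBoundary (p : unitInterval) {n m : ℕ} (hnm : n ≤ m) {x : Site 3}
    (hx : x ∈ box 3 n) :
    (bondPercolation (zdGraph 3) p).real (reachesOut m x) ≤
      (bondPercolation (zdGraph 3) p).real (siteToBoundary 3 (m - n)) := by
  calc (bondPercolation (zdGraph 3) p).real (reachesOut m x)
      ≤ (bondPercolation (zdGraph 3) p).real (DCT16.armEvent x (m - n)) :=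
        DCT16.real_mono_of_forall_subset_edgeSet _ _ fun ω hω h => armEvent_of_mem_reachesOut hnm hx hω h
    _ = (bondPercolation (zdGraph 3) p).real (siteToBoundary 3 (m - n)) := DCT16.real_armEvent p x _

/-- **One-arm bound for the pair event**: `P_p(pairBad m x x') ≤ P_p(0 ↔ ∂Λ_{m-n})` for `x ∈ Λ(n)`,
`n ≤ m` (drop the second arm and the non-junction). [folklore] -/
theorem real_pairBad_le_siteToBoundary (p : unitInterval) {n m : ℕ} (hnm : n ≤ m) {x : Site 3}
    (hx : x ∈ box 3 n) (x' : Site 3) :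
    (bondPercolation (zdGraph 3) p).real (pairBad m x x') ≤
      (bondPercolation (zdGraph 3) p).real (siteToBoundary 3 (m - n)) :=
  (measureReal_mono (fun _ h => h.1.1)).trans (real_reachesOut_le_siteToBoundary p hnm hx)

/-- **The gap `⌈n^{7/6}⌉ - n` tends to infinity** (indeed `≥ n` eventually). [folklore] -/
theorem tendsto_outer_sub_atTop : Tendsto (fun n : ℕ => outer n - n) atTop atTop := by
  refine tendsto_atTop_mono' atTop ?_ tendsto_id
  filter_upwards [NearLinearTwoClusterDecayPeelChain.eventually_mul_le_ceil_rpow 2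
    (by norm_num : (1 : ℝ) < 7 / 6)] with n hn
  simp only [outer, id]
  omega

/-- **The one-arm probability across the gap tends to `θ(p_c)`**:
`P_{p}(0 ↔ ∂Λ_{⌈n^{7/6}⌉ - n}) → θ(p)`. [folklore] -/
theorem tendsto_real_siteToBoundary_outer_sub (p : unitInterval) :
    Tendsto (fun n : ℕ => (bondPercolation (zdGraph 3) p).real (siteToBoundary 3 (outer n - n))) atTop
      (𝓝 (theta (zdGraph 3) 0 p)) :=
  (tendsto_real_siteToBoundary (d := 3) p).comp tendsto_outer_sub_atTop

/-- **Child 1 in the orthodox world, file-local vocabulary**: if `θ(p_c) = 0` then for every `ε > 0`,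
eventually `P_{p_c}(pairBad ⌈n^{7/6}⌉ x x') ≤ ε` for all `x, x' ∈ Λ(n)`. [folklore] -/
theorem pairDecay_of_theta_eq_zero (hθ : theta (zdGraph 3) 0 (criticalProbI 3) = 0) :
    ∀ ε : ℝ, 0 < ε → ∀ᶠ n : ℕ in atTop, ∀ x ∈ box 3 n, ∀ x' ∈ box 3 n,
      Pc.real (pairBad (outer n) x x') ≤ ε := by
  intro ε hε
  have ht := tendsto_real_siteToBoundary_outer_sub (criticalProbI 3)
  rw [hθ] at ht
  filter_upwards [(tendsto_order.1 ht).2 ε hε] with n hn x hx x' _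
  have hle : n ≤ outer n := le_nat_ceil_rpow (by norm_num : (1 : ℝ) ≤ 7 / 6) n
  exact (real_pairBad_le_siteToBoundary (criticalProbI 3) hle hx x').trans hn.le

end NearLinearTwoClusterDecaySplit

open MeasureTheory Filter Topology
open Literature.Probability.LatticeModels Literature.Probability.Percolation
open Summit.CriticalPhenomena.PercolationContinuityZ3.Theses.PercShatteringRace
open NearLinearTwoClusterDecaySplit

/-- **Stub `stub_pairDecayNullWorld` of the line `pair-decay-long-arms-dense`** (registered): in the
orthodox world `θ(p_c) = 0` the proposed sub-crux `PairTwoArmsDecay` holds — for every `ε > 0`,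
eventually in `n`, for all `x, x' ∈ Λ(n)`, the probability that both reach `∂ⁱⁿΛ(⌈n^{7/6}⌉)` inside
the box without being joined inside it is `≤ ε` (indeed `≤ P(0 ↔ ∂Λ_{⌈n^{7/6}⌉-n}) → θ(p_c) = 0`). [folklore] -/
theorem stub_pairDecayNullWorld :
    theta (zdGraph 3) 0 (criticalProbI 3) = 0 →
    ∀ ε : ℝ, 0 < ε → ∀ᶠ n : ℕ in Filter.atTop, ∀ x ∈ box 3 n, ∀ x' ∈ box 3 n,
      (bondPercolation (zdGraph 3) (criticalProbI 3)).real
        {ω | ∃ y ∈ innerBoundary (zdGraph 3) (box 3 ⌈(n : ℝ) ^ ((7 : ℝ) / 6)⌉₊),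
          ∃ y' ∈ innerBoundary (zdGraph 3) (box 3 ⌈(n : ℝ) ^ ((7 : ℝ) / 6)⌉₊),
            ω ∈ openConnIn ↑(box 3 ⌈(n : ℝ) ^ ((7 : ℝ) / 6)⌉₊) x y ∧
            ω ∈ openConnIn ↑(box 3 ⌈(n : ℝ) ^ ((7 : ℝ) / 6)⌉₊) x' y' ∧
            ω ∉ openConnIn ↑(box 3 ⌈(n : ℝ) ^ ((7 : ℝ) / 6)⌉₊) x x'} ≤ ε := by
  intro hθ ε hε
  filter_upwards [pairDecay_of_theta_eq_zero hθ ε hε] with n hn x hx x' hx'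
  have h := hn x hx x' hx'
  rwa [pairBad_eq] at h

/-- **`θ(p_c) = 0 ⇒ PairTwoArmsDecay`** (alias of the stub, for citation). [folklore] -/
theorem pairTwoArmsDecay_of_theta_eq_zero (hθ : theta (zdGraph 3) 0 (criticalProbI 3) = 0) :
    ∀ ε : ℝ, 0 < ε → ∀ᶠ n : ℕ in Filter.atTop, ∀ x ∈ box 3 n, ∀ x' ∈ box 3 n,
      (bondPercolation (zdGraph 3) (criticalProbI 3)).real
        {ω | ∃ y ∈ innerBoundary (zdGraph 3) (box 3 ⌈(n : ℝ) ^ ((7 : ℝ) / 6)⌉₊),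
          ∃ y' ∈ innerBoundary (zdGraph 3) (box 3 ⌈(n : ℝ) ^ ((7 : ℝ) / 6)⌉₊),
            ω ∈ openConnIn ↑(box 3 ⌈(n : ℝ) ^ ((7 : ℝ) / 6)⌉₊) x y ∧
            ω ∈ openConnIn ↑(box 3 ⌈(n : ℝ) ^ ((7 : ℝ) / 6)⌉₊) x' y' ∧
            ω ∉ openConnIn ↑(box 3 ⌈(n : ℝ) ^ ((7 : ℝ) / 6)⌉₊) x x'} ≤ ε :=
  stub_pairDecayNullWorld hθ

end Summit.CriticalPhenomena.PercolationContinuityZ3.Theorems
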